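import Literature.AlgebraicGeometry.Villamayor2007.EliminationAlgebra
import HarnessLib

/-!
# Villamayor 2007, Appendix 1 (1.18–1.23) and Def. 1.42 (1.42.3)–(1.42.4): the COMPUTABLE generators — the
# characteristic polynomials `ψ_{F_b^{(e)}(Y₁)}(V)`, the algebra `H_{F_b} ⊂ R̄_b`, and its specialization `ℋ_f ⊂ R̄_f`

O. E. Villamayor U., *Hypersurface singularities in positive characteristic*, Adv. Math. **213** (2007)
687–733 = arXiv:math/0606796 [Villamayor2007]; locators «p00NN Lnn» = chunk · line of the held arXiv text
(`lit read paper:arxiv-math_0606796`; chunks p0008, p0010, p0013–p0014 re-read before typing). Third file of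
the vocabulary `Literature/AlgebraicGeometry/Villamayor2007/` (after `UniversalElimination.lean`: `univMonic = F_b`,
`deltaOp = Δ^r`, `diffSubalgebra`, `univElimOne = R̄_b`; `EliminationAlgebra.lean`: `specialize`, `elimIdeal`,
`elimAlgebra = R̄_f`, `reesOfFamily`). Campaign `res-hironaka` (D-0089), ladder rung LIT-6. Real definitions,
elementary API PROVED, NO named facts; nothing of Hironaka's 2017 manuscript is referred to. This is the form in
which Bravo–Villamayor describe the elimination algebra («generated by the (weighted) coefficients of the
characteristic polynomial … closed under the differential operators of the base», [BravoVillamayor2010] ¶2.8–2.9,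
as quoted in `Resolution/PointBlowupElimination.lean`) — the generators one actually computes.

## What is typed, and how

* **1.7 / Remark 1.8 p0008 L1–L27, Lemma 1.9: the elements `F_b^{(e)}(Y_j)`.** `F_b^{(e)}(Z) = Δ^{(e)}(F_b(Z))`
  evaluated at `Z = Y_j`: `univMonicDeltaAt e j`. PROVED (Remark 1.8 «`F_b(T+Z) = (T + (Z − Y₁))⋯(T + (Z − Y_b))`»
  at `Z = Y_j`, Lemma 1.9 «`F_b^{(e)}(Y₁) = ± t_{b−1,b−e}(Y₁ − Y_j)`»): `taylor_univMonic_X` (`F_b(Z + Y_j) =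
  ∏_i (Z + (Y_j − Y_i))`), `univMonicDeltaAt_eq_esymm` (`F_b^{(e)}(Y_j)` is the `(b−e)`-th elementary symmetric
  function of the differences `Y_j − Y_i`, `i ∈ ι` — the printed sign `(−1)^{b−e}` of Eq. (1.8.1) belongs to the
  source's convention `F_b = Z^b − s_{b,1}Z^{b−1} + …`; here `esymm` of the differences themselves, no sign),
  hence `univMonicDeltaAt_mem_diffSubalgebra` and homogeneity of degree `b − e` (`isHomogeneous_univMonicDeltaAt`,
  p0013 L28–L29 «each `F_{c_i}^{(j)}(Y₁)` is homogeneous of degree `c_i − j`»).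
* **1.18 / Lemma 1.19 p0010 L1–L16: characteristic polynomials.** «Multiplication by an element `Θ ∈
  k[s_{b,1},…,s_{b,b}][Y₁]` defines an endomorphism … with characteristic polynomial `ψ_Θ(V)`» and Lemma 1.19:
  «`ψ_Θ(V) = ∏_{1≤j≤b} (V − (a₀ + a₁Y_j + … + a_{b−1}Y_j^{b−1}))`». We TYPE `ψ` BY THE PRODUCT FORMULA of Lemma 1.19
  (faithful up to that printed lemma; the free-module / endomorphism description of 1.18 is not formalised):
  for `q ∈ k[Y][T]`, `charPolyOf q := ∏_j (V − q(Y_j)) ∈ k[Y][V]`. PROVED: monic of degree `b`; when the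
  coefficients of `q` are symmetric, the coefficients of `ψ_q` are symmetric (`isSymmetric_coeff_charPolyOf`,
  Cor. 1.20's mechanism «each `β_j` is a restriction of an element in `𝕊_b`»).
* **Def. 1.21 p0010 L50–L53: `H_{F_b}`.** «the `k`-subalgebra of `k[s_{b,1},…,s_{b,b}]` generated by the
  coefficients of the `b − 1` characteristic polynomials `ψ_{F_b^{(e)}(Y₁)}(V)`, `1 ≤ e ≤ b − 1`»: `hGenSet ι k`,
  `hSubalgebra ι k := Algebra.adjoin k (hGenSet ι k)`. PROVED **Lemma 1.22** (p0010 L55–L65): `H_{F_b} ⊆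
  k[Y_i − Y_j]` (`hSubalgebra_le_diffSubalgebra`) and `H_{F_b} ⊆ R_b` (`hSubalgebra_le_symmetricSubalgebra`), hence
  `H_{F_b} ⊆ R̄_b` (`hSubalgebra_le_univElimOne`; = the inclusion i) in the proof of Prop. 1.23, p0010 L84–L88
  «the coefficients of `ψ_{F_b^{(e)}(Y₁)}(V)` are in the ring `R̄_b`»). Prop. 1.23 itself («`R̄_b` is the integral
  closure of `H_{F_b}`») is a theorem of the source and is NOT minted.
* **Def. 1.42 (1.42.3)–(1.42.4) p0014 L47–L64, `r = 1`: `ℋ_f ⊂ R̄_f`.** «In the same way we define `ℋ_{f}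
  (⊂ S[W])` as the subalgebra of `S[W]` generated by the image of `U^{(2)}` … `ℋ_f ⊂ R̄_f` and this ring extension is
  finite»: `hElimIdeal k a r` (span of the specializations of the degree-`r` homogeneous members of `H_{F_b}`),
  `hElimAlgebra k a := reesOfFamily S (hElimIdeal k a)`; PROVED `hElimIdeal_le_elimIdeal`, `hElimAlgebra_le_elimAlgebra`
  ((1.42.4), inclusion only; finiteness not proved).

## References

* O. E. Villamayor U., Adv. Math. 213 (2007) 687–733 = arXiv:math/0606796: 1.7–1.9, 1.18–1.23, Def. 1.42.
  [Villamayor2007]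
* A. Bravo, O. E. Villamayor U., Adv. Math. 224 (2010) 1349–1418 = arXiv:0807.4308, ¶2.8–2.9. [BravoVillamayor2010]
-/

noncomputable section

open scoped Polynomial

namespace Literature.AlgebraicGeometry.Villamayor2007

open MvPolynomial

universe u v w

variable {ι : Type u} {k : Type v} [CommRing k]

/-! ## A coefficient lemma: products of polynomials with coefficients in a subalgebra -/

/-- Coefficients of a finite product of polynomials lie in a subalgebra `A ⊆ k[Y]` as soon as all coefficients of
all factors do (used for Lemma 1.22; elementary). [cite: Villamayor2007, Lemma 1.22] -/
theorem coeff_prod_mem_subalgebra {α : Type w} (A : Subalgebra k (MvPolynomial ι k)) (s : Finset α)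
    (f : α → (MvPolynomial ι k)[X]) (h : ∀ a ∈ s, ∀ n, (f a).coeff n ∈ A) (n : ℕ) :
    (∏ a ∈ s, f a).coeff n ∈ A := by
  induction s using Finset.cons_induction generalizing n with
  | empty =>
    rw [Finset.prod_empty, Polynomial.coeff_one]
    split_ifs
    · exact A.one_mem
    · exact A.zero_mem
  | cons a s ha ih =>
    rw [Finset.prod_cons, Polynomial.coeff_mul]
    refine A.sum_mem fun ij _ => A.mul_mem ?_ ?_
    · exact h a (Finset.mem_cons_self a s) ij.1
    · exact ih (fun a' ha' m => h a' (Finset.mem_cons_of_mem ha') m) ij.2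

/-! ## 1.7 / Remark 1.8 / Lemma 1.9: the elements `F_b^{(e)}(Y_j)` -/

variable (ι k) in
/-- **`F_b^{(e)}(Y_j)`** [Villamayor 2007, 1.7 p0008 L1–L9 «`F_b^{(e)}(Y₁)` … the natural identification
`k[s_{b,1},…,s_{b,b}][Y₁] = k[s][Z]/⟨F_b(Z)⟩`», Lemma 1.9 p0008 L40–L46]: the Hasse derivative `Δ^{(e)}(F_b(Z))`
(`univMonicDelta`) evaluated at `Z = Y_j`. [cite: Villamayor2007, 1.7] -/
def univMonicDeltaAt [Fintype ι] (e : ℕ) (j : ι) : MvPolynomial ι k :=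
  (univMonicDelta ι k e).eval (X j)

/-- `F_b^{(e)}(Y_j)` is the coefficient of `T^e` in `F_b(Y_j + T)` (Def. 1.2 `Tay`, Mathlib `taylor_coeff`).
[cite: Villamayor2007, Def. 1.2] -/
theorem univMonicDeltaAt_eq_coeff_taylor [Fintype ι] (e : ℕ) (j : ι) :
    univMonicDeltaAt ι k e j = (Polynomial.taylor (X j) (univMonic ι k)).coeff e := by
  rw [univMonicDeltaAt, univMonicDelta, deltaOp, Polynomial.taylor_coeff]

/-- **Remark 1.8 at `Z = Y_j`** [Villamayor 2007, Remark 1.8 p0008 L16–L19 «`F_b(T+Z) = (T + (Z − Y₁))·(T + (Z −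
Y₂))⋯(T + (Z − Y_b))`»]: `F_b(Z + Y_j) = ∏_i (Z + (Y_j − Y_i))`. [cite: Villamayor2007, Remark 1.8] -/
theorem taylor_univMonic_X [Fintype ι] (j : ι) :
    Polynomial.taylor (X j) (univMonic ι k) =
      ∏ i : ι, (Polynomial.X + Polynomial.C (X j - X i : MvPolynomial ι k)) := by
  rw [univMonic]
  change Polynomial.taylorAlgHom (X j) (∏ i : ι, (Polynomial.X - Polynomial.C (X i))) = _
  rw [map_prod]
  refine Finset.prod_congr rfl fun i _ => ?_
  change Polynomial.taylor (X j) (Polynomial.X - Polynomial.C (X i)) = _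
  rw [map_sub, Polynomial.taylor_X, Polynomial.taylor_C, map_sub]
  ring

/-- **Lemma 1.9 / Eq. (1.8.1) at `Z = Y_j`** [Villamayor 2007, Lemma 1.9 p0008 L40–L54 «`F_b^{(e)}(Y₁) =
(−1)^{b−e} t_{b−1,b−e}(Y₁ − Y_j)` … `s_{b,b−e}(Y₁ − Y₁, Y₁ − Y₂, …, Y₁ − Y_b) = t_{b−1,b−e}(Y₁ − Y₂, …, Y₁ − Y_b)`»]:
for `e ≤ b`, `F_b^{(e)}(Y_j)` is the `(b − e)`-th elementary symmetric function of the differences `Y_j − Y_i`,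
`i ∈ ι` (the term `i = j` is `0`, which is the printed passage from `s_{b,·}` to `t_{b−1,·}`; the printed sign
`(−1)^{b−e}` reflects the source's sign convention for `s_{b,i}` in `F_b = Z^b − s_{b,1}Z^{b−1} + …` — here the
symmetric function is taken of the differences themselves). [cite: Villamayor2007, Lemma 1.9] -/
theorem univMonicDeltaAt_eq_esymm [Fintype ι] {e : ℕ} (he : e ≤ Fintype.card ι) (j : ι) :
    univMonicDeltaAt ι k e j =
      ((Finset.univ : Finset ι).val.map fun i => (X j - X i : MvPolynomial ι k)).esymm (Fintype.card ι - e) := by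
  rw [univMonicDeltaAt_eq_coeff_taylor, taylor_univMonic_X, Finset.prod_eq_multiset_prod]
  have h := Multiset.prod_X_add_C_coeff' (Finset.univ : Finset ι).val
    (fun i => (X j - X i : MvPolynomial ι k)) (k := e) (by simpa using he)
  simpa using h

/-- `F_b^{(e)}(Y_j) ∈ k[Y_i − Y_{i'}]` — the first half of Lemma 1.22 for the generators (p0010 L58–L60
«`t_{b−1,b−e}(Y₁ − Y_j)` is homogeneous in `k[Y₁ − Y₂, …, Y₁ − Y_b]`»). [cite: Villamayor2007, Lemma 1.22] -/
theorem univMonicDeltaAt_mem_diffSubalgebra [Fintype ι] (e : ℕ) (j : ι) :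
    univMonicDeltaAt ι k e j ∈ diffSubalgebra ι k := by
  rw [univMonicDeltaAt_eq_coeff_taylor, taylor_univMonic_X]
  refine coeff_prod_mem_subalgebra (diffSubalgebra ι k) _ _ (fun i _ n => ?_) e
  rw [Polynomial.coeff_add, Polynomial.coeff_X, Polynomial.coeff_C]
  refine (diffSubalgebra ι k).add_mem ?_ ?_
  · split_ifs
    · exact (diffSubalgebra ι k).one_mem
    · exact (diffSubalgebra ι k).zero_mem
  · split_ifs
    · exact X_sub_X_mem_diffSubalgebra j i
    · exact (diffSubalgebra ι k).zero_mem

/-- The elementary symmetric functions of a family of homogeneous polynomials of a common degree `d` are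
homogeneous of degree `m·d` (used for Cor. 1.20 / Lemma 1.22). [cite: Villamayor2007, Corollary 1.20] -/
theorem isHomogeneous_esymm_map {α : Type w} (s : Finset α) (c : α → MvPolynomial ι k) {d : ℕ}
    (hc : ∀ a ∈ s, (c a).IsHomogeneous d) (m : ℕ) :
    ((s.val.map c).esymm m).IsHomogeneous (m * d) := by
  rw [Finset.esymm_map_val]
  refine IsHomogeneous.sum _ _ _ fun t ht => ?_
  have htc : t.card = m := (Finset.mem_powersetCard.mp ht).2
  have hts : t ⊆ s := (Finset.mem_powersetCard.mp ht).1
  have h := IsHomogeneous.prod t c (fun _ => d) fun a ha => hc a (hts ha)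
  simpa [Finset.sum_const, htc, smul_eq_mul] using h

/-- **`F_b^{(e)}(Y_j)` is homogeneous of degree `b − e`** [Villamayor 2007, Prop. 1.28 1) / p0013 L28–L29 «each
`F_{c_i}^{(j)}(Y₁)` is homogeneous of degree `c_i − j`»; Remark 1.8 p0008 L35 «each `F_b^{(e)}(Z)` is homogeneous»].
[cite: Villamayor2007, Remark 1.8] -/
theorem isHomogeneous_univMonicDeltaAt [Fintype ι] {e : ℕ} (he : e ≤ Fintype.card ι) (j : ι) :
    (univMonicDeltaAt ι k e j).IsHomogeneous (Fintype.card ι - e) := by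
  rw [univMonicDeltaAt_eq_esymm he]
  have h := isHomogeneous_esymm_map (Finset.univ : Finset ι) (fun i => (X j - X i : MvPolynomial ι k))
    (d := 1) (fun i _ => (isHomogeneous_X k j).sub (isHomogeneous_X k i)) (Fintype.card ι - e)
  simpa using h

/-! ## 1.18 / Lemma 1.19: characteristic polynomials, by the product formula -/

variable (ι k) in
/-- **Characteristic polynomial `ψ_Θ(V)`** [Villamayor 2007, 1.18 p0010 L1–L7 and Lemma 1.19 p0010 L9–L16]:
for `Θ = a₀ + a₁Y₁ + … + a_{b−1}Y₁^{b−1} ∈ k[s][Y₁]`, «`ψ_Θ(V) = ∏_{1≤j≤b} (V − (a₀ + a₁Y_j + … + a_{b−1}Y_j^{b−1}))`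
(i.e., the coefficients `h_i` are, up to sign, the symmetric polynomials evaluated at the elements
`a₀ + a₁Y_j + … + a_{b−1}Y_j^{b−1}`)». TYPED by this product formula for any `q ∈ k[Y][T]` standing for `Θ` (a
polynomial in ONE variable `T ↦ Y_j` with coefficients in `k[Y]`): `ψ_q(V) := ∏_j (V − q(Y_j))`; both `T` and `V` are
Mathlib's `Polynomial.X`. The endomorphism/free-module description of 1.18 is not formalised (Lemma 1.19 says the
two agree). [cite: Villamayor2007, Lemma 1.19] -/
def charPolyOf [Fintype ι] (q : (MvPolynomial ι k)[X]) : (MvPolynomial ι k)[X] :=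
  ∏ j : ι, (Polynomial.X - Polynomial.C (q.eval (X j)))

/-- `ψ_q(V)` is monic (a characteristic polynomial, 1.18 «`ψ_Θ(V) = V^b + h₁V^{b−1} + … + h_b`»).
[cite: Villamayor2007, 1.18] -/
theorem charPolyOf_monic [Fintype ι] (q : (MvPolynomial ι k)[X]) : (charPolyOf ι k q).Monic :=
  Polynomial.monic_prod_of_monic _ _ fun _ _ => Polynomial.monic_X_sub_C _

/-- `ψ_q(V)` has degree `b` (1.18). [cite: Villamayor2007, 1.18] -/
theorem natDegree_charPolyOf [Fintype ι] [Nontrivial k] (q : (MvPolynomial ι k)[X]) :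
    (charPolyOf ι k q).natDegree = Fintype.card ι := by
  rw [charPolyOf, Polynomial.natDegree_prod_of_monic _ _ fun _ _ => Polynomial.monic_X_sub_C _]
  simp

/-- Lemma 1.19 1): «`ψ_Θ(Θ) = 0`» in the form: `Θ(Y_j)` is a root of `ψ_Θ` for every `j`.
[cite: Villamayor2007, Lemma 1.19] -/
theorem eval_charPolyOf_self [Fintype ι] (q : (MvPolynomial ι k)[X]) (j : ι) :
    (charPolyOf ι k q).eval (q.eval (X j)) = 0 := by
  rw [charPolyOf, Polynomial.eval_prod]
  exact Finset.prod_eq_zero (Finset.mem_univ j) (by simp)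

/-- A permutation of the variables permutes the roots `q(Y_j)` of `ψ_q` when `q` has invariant coefficients
(Lemma 1.19 2) / Cor. 1.20 «each `β_j` is a restriction of an element in `𝕊_b`»): then it fixes every coefficient
of `ψ_q`. [cite: Villamayor2007, Corollary 1.20] -/
theorem rename_coeff_charPolyOf [Fintype ι] (q : (MvPolynomial ι k)[X]) (σ : Equiv.Perm ι)
    (hq : Polynomial.map (rename σ).toRingHom q = q) (n : ℕ) :
    rename σ ((charPolyOf ι k q).coeff n) = (charPolyOf ι k q).coeff n := by
  have hroot : ∀ j, rename σ (q.eval (X j)) = q.eval (X (σ j)) := by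
    intro j
    have h := Polynomial.hom_eval₂ q (RingHom.id _) (rename σ).toRingHom (X j)
    rw [Polynomial.eval]
    rw [AlgHom.toRingHom_eq_coe, RingHom.coe_coe] at h
    rw [h, ← Polynomial.eval_map]
    rw [AlgHom.toRingHom_eq_coe] at hq
    simp only [RingHomCompTriple.comp_eq]
    rw [hq, rename_X]
  have hmap : Polynomial.map (rename σ).toRingHom (charPolyOf ι k q) = charPolyOf ι k q := by
    rw [charPolyOf, Polynomial.map_prod]
    simp only [AlgHom.toRingHom_eq_coe, Polynomial.map_sub, Polynomial.map_X, Polynomial.map_C,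
      RingHom.coe_coe, hroot]
    exact Fintype.prod_equiv σ (fun j => Polynomial.X - Polynomial.C (q.eval (X (σ j))))
      (fun j => Polynomial.X - Polynomial.C (q.eval (X j))) fun _ => rfl
  have h := congrArg (fun p => p.coeff n) hmap
  simpa only [Polynomial.coeff_map, AlgHom.toRingHom_eq_coe, RingHom.coe_coe] using h

/-- The Hasse derivatives `F_b^{(e)}(Z)` of the universal polynomial have symmetric coefficients (they are
`± s_{b,b−e}(Z − Y₁,…,Z − Y_b)`, Remark 1.8 p0008 L30–L35 «`k[Z − Y₁,…,Z − Y_b]^{𝕊_b} = k[{F_b^{(e)}(Z)}]`»).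
[cite: Villamayor2007, Remark 1.8] -/
theorem map_rename_univMonicDelta [Fintype ι] (e : ℕ) (σ : Equiv.Perm ι) :
    Polynomial.map (rename σ).toRingHom (univMonicDelta ι k e) = univMonicDelta ι k e := by
  ext n
  rw [Polynomial.coeff_map, univMonicDelta, deltaOp, Polynomial.hasseDeriv_coeff, AlgHom.toRingHom_eq_coe,
    RingHom.coe_coe, map_mul, map_natCast, isSymmetric_coeff_univMonic (n + e) σ]

/-- **Cor. 1.20 / Lemma 1.22 (symmetric part)**: the coefficients of `ψ_{F_b^{(e)}(Y₁)}(V)` are symmetric, i.e. lie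
in `R_b = k[s_{b,1},…,s_{b,b}]` (Def. 1.21 places `H_{F_b}` inside `k[s]`). [cite: Villamayor2007, Lemma 1.22] -/
theorem isSymmetric_coeff_charPolyOf_univMonicDelta [Fintype ι] (e n : ℕ) :
    ((charPolyOf ι k (univMonicDelta ι k e)).coeff n).IsSymmetric :=
  fun σ => rename_coeff_charPolyOf _ σ (map_rename_univMonicDelta e σ) n

/-- **Lemma 1.22 (difference part) for the generators**: the coefficients of `ψ_{F_b^{(e)}(Y₁)}(V)` lie in
`k[Y_i − Y_j]` (p0010 L55–L64 «The coefficients of the characteristic polynomial of `F_b^{(e)}(Y₁)` are symmetric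
polynomials on `{F_b^{(e)}(Y_j) / 1 ≤ j ≤ b}`, so they are also homogeneous elements in `k[Y₁ − Y₂, …, Y₁ − Y_b]`»).
[cite: Villamayor2007, Lemma 1.22] -/
theorem coeff_charPolyOf_univMonicDelta_mem_diffSubalgebra [Fintype ι] (e n : ℕ) :
    (charPolyOf ι k (univMonicDelta ι k e)).coeff n ∈ diffSubalgebra ι k := by
  refine coeff_prod_mem_subalgebra (diffSubalgebra ι k) _ _ (fun j _ m => ?_) n
  rw [Polynomial.coeff_sub, Polynomial.coeff_X, Polynomial.coeff_C]
  refine (diffSubalgebra ι k).sub_mem ?_ ?_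
  · split_ifs
    · exact (diffSubalgebra ι k).one_mem
    · exact (diffSubalgebra ι k).zero_mem
  · split_ifs
    · exact univMonicDeltaAt_mem_diffSubalgebra e j
    · exact (diffSubalgebra ι k).zero_mem

/-- **Cor. 1.20 (homogeneity)** [Villamayor 2007, Corollary 1.20 p0010 L35–L41 «the coefficients of the
characteristic polynomial `ψ_Θ(V)` are weighted homogeneous in `k[s]` (i.e., are homogeneous in `k[Y₁,…,Y_b]`)»]:
for `e ≤ b` and `n ≤ b`, `coeff_n ψ_{F_b^{(e)}(Y₁)}` is homogeneous of degree `(b − n)(b − e)` (it is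
`± s_{b−n}` of the `b` roots, each homogeneous of degree `b − e`). [cite: Villamayor2007, Corollary 1.20] -/
theorem isHomogeneous_coeff_charPolyOf_univMonicDelta [Fintype ι] {e n : ℕ} (he : e ≤ Fintype.card ι)
    (hn : n ≤ Fintype.card ι) :
    ((charPolyOf ι k (univMonicDelta ι k e)).coeff n).IsHomogeneous
      ((Fintype.card ι - n) * (Fintype.card ι - e)) := by
  have hprod : charPolyOf ι k (univMonicDelta ι k e) =
      ((Finset.univ : Finset ι).val.map fun j =>
        Polynomial.X - Polynomial.C (univMonicDeltaAt ι k e j)).prod := by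
    rw [charPolyOf, Finset.prod_eq_multiset_prod]; rfl
  rw [hprod]
  have h := Multiset.prod_X_sub_C_coeff
    ((Finset.univ : Finset ι).val.map fun j => univMonicDeltaAt ι k e j) (k := n) (by simpa using hn)
  rw [Multiset.map_map, Function.comp_def] at h
  rw [h]
  simp only [Multiset.card_map, Finset.card_val, Finset.card_univ]
  have h1 : ((-1 : MvPolynomial ι k) ^ (Fintype.card ι - n)).IsHomogeneous 0 := by
    have := isHomogeneous_C ι ((-1 : k) ^ (Fintype.card ι - n))
    simpa using this
  have h2 := isHomogeneous_esymm_map (Finset.univ : Finset ι) (fun j => univMonicDeltaAt ι k e j)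
    (fun j _ => isHomogeneous_univMonicDeltaAt he j) (Fintype.card ι - n)
  simpa using h1.mul h2

/-- `ψ_q(V)` has degree at most `b` (no nontriviality needed). [cite: Villamayor2007, 1.18] -/
theorem natDegree_charPolyOf_le [Fintype ι] (q : (MvPolynomial ι k)[X]) :
    (charPolyOf ι k q).natDegree ≤ Fintype.card ι := by
  rw [charPolyOf]
  refine (Polynomial.natDegree_prod_le _ _).trans ?_
  refine (Finset.sum_le_sum fun j _ => Polynomial.natDegree_X_sub_C_le _).trans ?_
  simp

/-! ## Def. 1.21 / Lemma 1.22: the algebra `H_{F_b} ⊆ R̄_b` -/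

variable (ι k) in
/-- **Generators of `H_{F_b}`** [Villamayor 2007, Def. 1.21 p0010 L50–L53]: «the coefficients of the `b − 1`
characteristic polynomials `ψ_{F_b^{(e)}(Y₁)}(V)`, for `1 ≤ e ≤ b − 1`». [cite: Villamayor2007, Def. 1.21] -/
def hGenSet [Fintype ι] : Set (MvPolynomial ι k) :=
  {c | ∃ e n : ℕ, 1 ≤ e ∧ e + 1 ≤ Fintype.card ι ∧ c = (charPolyOf ι k (univMonicDelta ι k e)).coeff n}

variable (ι k) in
/-- **The algebra `H_{F_b}`** [Villamayor 2007, Def. 1.21 p0010 L50–L53]: «Let `H_{F_b}` be the `k`-subalgebra of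
`k[s_{b,1},…,s_{b,b}]` generated by the coefficients of the `b − 1` characteristic polynomials, say
`ψ_{F_b^{(e)}(Y₁)}(V)`, for `1 ≤ e ≤ b − 1`» — the COMPUTABLE subalgebra of `R̄_b` with the same integral closure
(Prop. 1.23, not proved here). [cite: Villamayor2007, Def. 1.21] -/
def hSubalgebra [Fintype ι] : Subalgebra k (MvPolynomial ι k) :=
  Algebra.adjoin k (hGenSet ι k)

/-- The generating coefficients lie in `H_{F_b}`. [cite: Villamayor2007, Def. 1.21] -/
theorem coeff_charPolyOf_mem_hSubalgebra [Fintype ι] {e : ℕ} (he1 : 1 ≤ e) (he : e + 1 ≤ Fintype.card ι)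
    (n : ℕ) : (charPolyOf ι k (univMonicDelta ι k e)).coeff n ∈ hSubalgebra ι k :=
  Algebra.subset_adjoin ⟨e, n, he1, he, rfl⟩

/-- **Lemma 1.22, first part** [Villamayor 2007, Lemma 1.22 p0010 L55]: «`H_{F_b}` is included in `k[Y₁ − Y₂, Y₁ −
Y₃, …, Y₁ − Y_b]`». [cite: Villamayor2007, Lemma 1.22] -/
theorem hSubalgebra_le_diffSubalgebra [Fintype ι] : hSubalgebra ι k ≤ diffSubalgebra ι k :=
  Algebra.adjoin_le (by
    rintro _ ⟨e, n, -, -, rfl⟩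
    exact coeff_charPolyOf_univMonicDelta_mem_diffSubalgebra e n)

/-- **Lemma 1.22, second part** [Villamayor 2007, Lemma 1.22 p0010 L55–L56 «it is a graded subalgebra of
`k[s_{b,1},…,s_{b,b}]`»]: `H_{F_b} ⊆ R_b` = Mathlib's symmetric subalgebra. [cite: Villamayor2007, Lemma 1.22] -/
theorem hSubalgebra_le_symmetricSubalgebra [Fintype ι] : hSubalgebra ι k ≤ symmetricSubalgebra ι k :=
  Algebra.adjoin_le (by
    rintro _ ⟨e, n, -, -, rfl⟩
    exact isSymmetric_coeff_charPolyOf_univMonicDelta e n)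

/-- **`H_{F_b} ⊆ R̄_b`** (the inclusion i) in the proof of Prop. 1.23, p0010 L84–L88 «the coefficients of
`ψ_{F_b^{(e)}(Y₁)}(V)` are in the ring `R̄_b`»). Prop. 1.23 itself — `R̄_b` is the integral closure of `H_{F_b}` in
`k[s]` — is NOT proved here. [cite: Villamayor2007, Proposition 1.23] -/
theorem hSubalgebra_le_univElimOne [Fintype ι] : hSubalgebra ι k ≤ univElimOne ι k := by
  rw [univElimOne_eq]
  exact le_inf hSubalgebra_le_diffSubalgebra hSubalgebra_le_symmetricSubalgebra

/-- `H_{F_b}` is GRADED (Lemma 1.22 «graded subalgebra»; Cor. 1.20): generated by homogeneous elements, hence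
closed under homogeneous components. [cite: Villamayor2007, Lemma 1.22] -/
theorem homogeneousComponent_mem_hSubalgebra [Fintype ι] {p : MvPolynomial ι k} (hp : p ∈ hSubalgebra ι k)
    (m : ℕ) : homogeneousComponent m p ∈ hSubalgebra ι k := by
  refine homogeneousComponent_mem_adjoin_of_homogeneous ?_ hp m
  rintro _ ⟨e, n, -, he, rfl⟩
  by_cases hn : n ≤ Fintype.card ι
  · exact ⟨_, isHomogeneous_coeff_charPolyOf_univMonicDelta (by omega) hn⟩
  · refine ⟨0, ?_⟩
    rw [Polynomial.coeff_eq_zero_of_natDegree_lt ((natDegree_charPolyOf_le _).trans_lt (by omega))]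
    exact isHomogeneous_zero ι k 0

/-! ## Def. 1.42 (1.42.3)–(1.42.4), `r = 1`: the specialized algebra `ℋ_f ⊂ R̄_f ⊂ S[W]` -/

section Specialized

variable (k) {S : Type w} [CommRing S] [Algebra k S] {b : ℕ}

/-- Degree-`r` generators of `ℋ_f`: specializations of the homogeneous degree-`r` members of `H_{F_b}`
(p0013 L120–L124 «`H(s)·W^{d_H}`, where `H` is an homogeneous element of degree `d_H` … (in `H_{F_{c₁},…,F_{c_r}}`)»,
here `r = 1`). [cite: Villamayor2007, Def. 1.42] -/
def hElimGen (a : Fin b → S) (r : ℕ) : Set S :=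
  {x | ∃ (H : MvPolynomial (Fin b) k) (hH : H ∈ hSubalgebra (Fin b) k), H.IsHomogeneous r ∧
    x = specialize k a ⟨H, hSubalgebra_le_symmetricSubalgebra hH⟩}

/-- The ideals `I^{(2)}_r` of `ℋ_f = ⊕ I^{(2)}_r W^r` (1.40 p0013 L126–L129, specialized as in Def. 1.42 (1.42.3)).
[cite: Villamayor2007, Def. 1.42] -/
def hElimIdeal (a : Fin b → S) (r : ℕ) : Ideal S :=
  Ideal.span (hElimGen k a r)

/-- **`ℋ_f ⊂ S[W]`** [Villamayor 2007, Def. 1.42 (1.42.3) p0014 L47–L54 «`ℋ_{f}` … the subalgebra of `S[W]`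
generated by the image of `U^{(2)} = Σ I^{(2)}_k W^k`»], for one polynomial (`r = 1`): the graded subring of the
family `hElimIdeal k a`. [cite: Villamayor2007, Def. 1.42] -/
def hElimAlgebra (a : Fin b → S) : Subalgebra S S[X] :=
  reesOfFamily S (hElimIdeal k a)

variable {k}

/-- `I^{(2)}_r ⊆ I^{(1)}_r = I_r` (1.40 p0013 L131–L132 «`I^{(2)}_k ⊂ I^{(1)}_k` for each positive index `k`»,
specialized). [cite: Villamayor2007, 1.40] -/
theorem hElimIdeal_le_elimIdeal (a : Fin b → S) (r : ℕ) : hElimIdeal k a r ≤ elimIdeal k a r := by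
  refine Ideal.span_le.mpr ?_
  rintro _ ⟨H, hH, hhom, rfl⟩
  exact specialize_mem_elimIdeal a ⟨hSubalgebra_le_univElimOne hH, hhom⟩

/-- **(1.42.4): `ℋ_f ⊂ R̄_f`** [Villamayor 2007, Def. 1.42 p0014 L56–L64 «`ℋ_{f} ⊂ R̄_{f}` and that this ring
extension is finite»] — the inclusion (finiteness, which rests on Prop. 1.23 / Prop. 1.38, is NOT proved here).
[cite: Villamayor2007, Def. 1.42] -/
theorem hElimAlgebra_le_elimAlgebra (a : Fin b → S) : hElimAlgebra k a ≤ elimAlgebra k a :=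
  reesOfFamily_mono fun r => hElimIdeal_le_elimIdeal a r

end Specialized

end Literature.AlgebraicGeometry.Villamayor2007

end
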